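import Mathlib
import HarnessLib
import Summits.Ventures.LatticeQCDFlow.Scaling.AbsoluteMomentCLT
import Summits.Ventures.LatticeQCDFlow.Scaling.GiniMeanDifferenceVarianceBounds

/-!
# LatticeQCDFlow / Scaling — the Gini mean difference of an i.i.d. sum grows like `2σ√(n/π)`:
# the exact large-volume constant `σ/√π` of the strong-coupling acceptance slope

HONEST FRAMING: exact (Metropolis-corrected) sampling algorithms for lattice gauge theory;
figures of merit are autocorrelation/cost numbers at stated couplings and volumes; no
continuum-physics claim.

Venture `LatticeQCDFlow` (cell pub-lqcd), topic `Scaling`; FANOUT row 3 (`s0-u1-a`, S0-B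
implementation A, GEN-19).  NEW WORK of the cell (assembly), not a published result; NO definition
is introduced; nothing is cited.  Parents (in the tree): row 3's `Scaling/AbsoluteMomentCLT` (the
first absolute moment in the CLT for the rows of a product family) and
`Scaling/GiniMeanDifferenceVarianceBounds` (`E_{μ⊗μ}(T − T′)² = 2·Var T`, the iterated form of the
pair integral).

## Why (the cell's question)

For a factorised ("`V` independent blocks") exact flow sampler whose proposal is the reference law
itself, row 3's GEN-17 (D) identified the first-order strong-coupling law of the equilibrium
acceptance, `(1 − acc_V(β))/β → s_V = ½·E|T_V − T_V′|` — half the Gini mean difference of the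
block-sum statistic `T_V = Σᵢ g(xᵢ)` under the product reference law — and GEN-18 pinned it to
`√V` from both sides (`σ√(V/6) ≤ s_V ≤ σ√(V/3)`; `Scaling/U1IdentityFlowSlopeVolumeSandwich`:
`√(V/12) ≤ s_V ≤ √(V/6)` for U(1)), listing the exact constant as NOT CLAIMED.  This file computes
it: **`s_V/√V → σ/√π`** (`σ² = Var g`), i.e. `E|T_V − T_V′| ∼ 2σ√(V/π)`, the mean absolute value of
the Gaussian limit of `T_V − T_V′`.  (U(1): `σ² = ½`, constant `1/√(2π) ≈ 0.399` inside
`[1/√12, 1/√6] ≈ [0.289, 0.408]`; SU(2) class angles: `σ² = ¼`, constant `1/(2√π) ≈ 0.282` inside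
`[1/√24, 1/√12]` — those readings are filed on the one-angle moment files.)

## Content (all `[ours]`)

* `pi_integral_abs_sum_sub_eq_integral_integral` — the doubled-block bridge
  `∫|Σᵢ(g(yᵢ⁽¹⁾) − g(yᵢ⁽²⁾))| d(ν⊗ν)^{⊗n} = ∫∫|Σᵢ g(xᵢ) − Σᵢ g(xᵢ′)| dν^{⊗n} dν^{⊗n}` (Mathlib's
  `measurePreserving_arrowProdEquivProdArrow`);
* **`pi_halfGini_sum_div_sqrt_tendsto`** — for ANY block law `ν` and ANY `g ∈ L²(ν)`:
  `(½∫∫|Σᵢ g(xᵢ) − Σᵢ g(xᵢ′)| dν^{⊗n} dν^{⊗n})/√n → √(Var g/π)`, in exactly the `Measure.pi`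
  normalisation of `Scaling/U1IdentityFlowSlopeVolumeSandwich`.

Reading (value-free): to first order in the coupling, the acceptance deficit of the untrained
factorised sampler is `β·σ√(V/π)·(1 + o(1))` as `V → ∞` — the `√V` law of GEN-18 with its exact
constant.  NOT CLAIMED: a rate in `V`; the torus (only the factorised model); trained flows; any
value at the cell's `(β, L)`; nothing re-scored.
-/

noncomputable section

namespace Summit.Ventures.LatticeQCDFlow.Theory2

open MeasureTheory ProbabilityTheory Filter Finset Real Set
open scoped Topology NNReal

/-! ## §5 Two independent copies: the Gini mean difference of an i.i.d. sum -/

section TwoCopies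

variable {X : Type*} {mX : MeasurableSpace X} {ν : Measure X} [IsProbabilityMeasure ν] {g : X → ℝ}

/-- The doubled-block bridge: the `Measure.pi` law of pairs is the pair of `Measure.pi` laws
(Mathlib's `measurePreserving_arrowProdEquivProdArrow`), read on the Gini functional. [ours] -/
theorem pi_integral_abs_sum_sub_eq_integral_integral (hg : MemLp g 2 ν) (n : ℕ) :
    ∫ y, |∑ i, (g (y i).1 - g (y i).2)| ∂(Measure.pi fun _ : Fin n => ν.prod ν)
      = ∫ x, ∫ x', |∑ i, g (x i) - ∑ i, g (x' i)|
          ∂(Measure.pi fun _ : Fin n => ν) ∂(Measure.pi fun _ : Fin n => ν) := by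
  have hT : Integrable (fun x : Fin n → X => ∑ i, g (x i)) (Measure.pi fun _ : Fin n => ν) :=
    (pi_memLp_sum hg n).integrable one_le_two
  rw [← integral_prod_abs_sub_eq hT]
  have h := (measurePreserving_arrowProdEquivProdArrow X X (Fin n) (fun _ => ν) (fun _ => ν)).integral_comp'
    (g := fun z : (Fin n → X) × (Fin n → X) => |∑ i, g (z.1 i) - ∑ i, g (z.2 i)|)
  rw [← h]
  refine integral_congr_ae (Filter.Eventually.of_forall fun y => ?_)
  simp only [Finset.sum_sub_distrib]
  rfl

/-- **THE GINI MEAN DIFFERENCE OF AN I.I.D. SUM GROWS LIKE `2σ√(n/π)`.**  For ANY block law `ν` and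
ANY square-integrable block statistic `g` (`σ² = Var g`), the half Gini mean difference of the
`n`-block sum `T_n = Σᵢ g(xᵢ)` — in the `Measure.pi` normalisation of
`Scaling/U1IdentityFlowSlopeVolumeSandwich`, i.e. the strong-coupling acceptance slope `s_n` of the
untrained factorised sampler by GEN-17 (D) — satisfies `s_n/√n → σ/√π`. [ours] -/
theorem pi_halfGini_sum_div_sqrt_tendsto (hg : MemLp g 2 ν) :
    Tendsto (fun n : ℕ => (1 / 2 * ∫ x, ∫ x', |∑ i, g (x i) - ∑ i, g (x' i)|
        ∂(Measure.pi fun _ : Fin n => ν) ∂(Measure.pi fun _ : Fin n => ν)) / Real.sqrt n)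
      atTop (𝓝 (Real.sqrt (Var[g; ν] / π))) := by
  -- the difference statistic on the doubled block
  have hD : MemLp (fun z : X × X => g z.1 - g z.2) 2 (ν.prod ν) :=
    (hg.comp_measurePreserving measurePreserving_fst).sub
      (hg.comp_measurePreserving measurePreserving_snd)
  have hgi : Integrable g ν := hg.integrable one_le_two
  have h0 : ∫ z, (g z.1 - g z.2) ∂(ν.prod ν) = 0 := by
    rw [integral_sub (hgi.comp_fst ν) (hgi.comp_snd ν), integral_fun_fst, integral_fun_snd]
    simp
  have hvar : Var[fun z : X × X => g z.1 - g z.2; ν.prod ν] = 2 * Var[g; ν] := by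
    rw [variance_eq_sub hD]
    have h2 : ∫ z, ((fun z : X × X => g z.1 - g z.2) ^ 2) z ∂(ν.prod ν) = 2 * Var[g; ν] := by
      simp only [Pi.pow_apply]
      exact integral_prod_sub_sq_eq hg
    have h1 : ∫ z, (fun z : X × X => g z.1 - g z.2) z ∂(ν.prod ν) = 0 := h0
    rw [h2, h1]
    ring
  have h4 := pi_integral_abs_sum_div_sqrt_tendsto hD h0
  rw [hvar] at h4
  have hlim : Real.sqrt (2 * (2 * Var[g; ν]) / π) = 2 * Real.sqrt (Var[g; ν] / π) := by
    rw [show 2 * (2 * Var[g; ν]) / π = 2 ^ 2 * (Var[g; ν] / π) by ring,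
      Real.sqrt_mul' _ (div_nonneg (variance_nonneg _ _) Real.pi_pos.le) , Real.sqrt_sq zero_le_two]
  rw [hlim] at h4
  have h5 := h4.const_mul (1 / 2 : ℝ)
  rw [show (1 / 2 : ℝ) * (2 * Real.sqrt (Var[g; ν] / π)) = Real.sqrt (Var[g; ν] / π) by ring] at h5
  refine h5.congr fun n => ?_
  rw [pi_integral_abs_sum_sub_eq_integral_integral hg n]
  ring

end TwoCopies

end Summit.Ventures.LatticeQCDFlow.Theory2

end
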